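import Literature.NumberTheory.Rogawski1990.LocalTransfer
import Literature.NumberTheory.Rogawski1990.EndoscopicClassTransfer
import Literature.NumberTheory.Automorphic.LocalUnitaryGroupUnimodularIsotropic
import Literature.NumberTheory.Automorphic.LocalUnitaryGroupCongr
import HarnessLib

/-!
# F0 · P3b · line «CMCharIdentityTest» — (C1) `stub_xiStablyInvariant`: one-dimensional characters of `H_v` are stable class functions

Cell `pub/hodgecm-mathlib`, crux H413 = `stmt-HodgeConjecture-24833`, route HCCMUnconditional; desk F0P3b-plan (g12) brief H1 of
`F0/P3b/PLAN-P3b.v14.F0P3b-plan-g12.md` §2 (tree stub `Cruxes/H413/Lines/F0_P3b_CMCharIdentityTestPaydown.lean` :293 `stub_xiStablyInvariant`);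
pen A-p19 (g21).  THEOREMS ONLY, sorry-free.  HONEST LABEL: HC_CM is proved only modulo the 2 remaining named inputs (hLiu418, h413) until rung 0
closes; this file discharges an ALGEBRA joint of print's «`χ_ξ` is a stable distribution» [Rogawski1990, §4.3 p. 43; §12.5 p. 183].

THE STATEMENT (C1, verbatim = the stub's Π-type with the line's `abbrev`s `Pl`, `HLoc` unfolded): for every character `ξ_v : H_v →* ℂˣ` of
`H_v = U(Φ₂)(L⁺_v) × U(Φ₁)(L⁺_v)` and all stably conjugate `a ∼_st b` (★ `IsLocalStablyConjH`: componentwise conjugate in the ambient `GL₂ × GL₁`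
over `L ⊗ L⁺_v`), `ξ_v(a) = ξ_v(b)`.  No continuity.

THE PROOF — SHORTER THAN THE BRIEF'S ROUTE, everything ★: stable conjugates in `U(Φ₁)` are EQUAL (★ `isStablyConj_iff_eq_of_fin_one`) and in `U(Φ₂)`
have the same determinant (`IsConj` in `GL₂` mapped by `GL₂ →* Rˣ`, `isConj_iff_eq` in the commutative `Rˣ`), so `b = a · (u, 1)` with `det u = 1`;
and **every homomorphism `U(Φ₂)(L⁺_v) →* A` into a commutative group kills the determinant-one elements** — ★
`UnitaryGroup.localPi_apply_eq_one_of_isotropic` (Dieudonné II §5 at non-split `v`, `GL_N`-abelianisation at split `v`) for the ISOTROPIC form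
`Φ₂` (★ `antidiagOne_isotropic`, `e₀`), transported along ★ `localPiEquiv` with ★ `det_localPiEquiv_symm_apply_eq_one`.  The desk's (C1-S)
«`SU(Φ₂) ≤ commutator`» ∕ (C1-U) are thereby not needed for (C1).

* `det_eq_of_isStablyConj` (generic `σ, J, n`), `apply_eq_one_of_det_eq_one_antidiagOne` (CM, every rank `N ≥ 2`, any commutative target),
  **`xiStablyInvariant`** (= the stub; closes it by `exact`).
-/

set_option autoImplicit false
set_option linter.dupNamespace false

noncomputable section

open NumberField IsDedekindDomain
open scoped Matrix MatrixGroups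
open Literature.NumberTheory.Rogawski1990 Literature.NumberTheory.Automorphic Literature.NumberTheory.Automorphic.UnitaryGroup
open Literature.AlgebraicGeometry.ShimuraVarieties (unitaryGroup)

namespace Summit.HodgeConjecture.HodgeConjecture.Cruxes.H413.F0P3bXiStablyInvariant

/-! ## §1 Stable conjugates have equal determinants -/

section Det

variable {R : Type*} [CommRing R] {n : Type*} [Fintype n] [DecidableEq n] {σ : R →+* R} {J : Matrix n n R}

/-- **Stably conjugate elements of `U_σ(J)(R)` have the same determinant** (they are conjugate in `GL_n(R)`; `det : GL_n(R) →* Rˣ` lands in a commutative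
group, where conjugacy is equality). [cite: Rogawski1990, §3.1 p. 19] -/
theorem det_eq_of_isStablyConj {γ δ : unitaryGroup σ J} (h : IsStablyConj σ J γ δ) :
    Matrix.GeneralLinearGroup.det (γ : GL n R) = Matrix.GeneralLinearGroup.det (δ : GL n R) :=
  isConj_iff_eq.1 (MonoidHom.map_isConj Matrix.GeneralLinearGroup.det h)

end Det

/-! ## §2 Characters of the quasi-split `U(Φ_N)(L⁺_v)` kill `SU`, on the `cmDatum` carrier -/

section CM

variable (L : Type) [Field L] [NumberField L] [IsCMField L]

/-- **Every homomorphism `U(Φ_N)(L⁺_v) →* A` (`A` commutative, `N ≥ 2`) is trivial on the elements of determinant `1`** — ★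
`localPi_apply_eq_one_of_isotropic` for the isotropic `Φ_N = antidiag(1,…,1)` (★ `antidiagOne_isotropic`), read on the carrier `(cmDatum L N Φ_N).Local v`
through ★ `localPiEquiv` (★ `det_localPiEquiv_symm_apply_eq_one`). [cite: Dieudonne1971GroupesClassiques, Chap. II §5] [cite: Rogawski1990, §4.8 p. 53] -/
theorem apply_eq_one_of_det_eq_one_antidiagOne {N : ℕ} (hN : 2 ≤ N) (v : HeightOneSpectrum (𝓞 ↥(maximalRealSubfield L))) {A : Type*} [CommGroup A]
    (θ : (cmDatum L N (Matrix.of fun i j : Fin N => if i.val + j.val + 1 = N then (1 : L) else 0)).Local v →* A)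
    (y : (cmDatum L N (Matrix.of fun i j : Fin N => if i.val + j.val + 1 = N then (1 : L) else 0)).Local v)
    (hy : Matrix.GeneralLinearGroup.det (y.1 : GL (Fin N) (LocalRing L v)) = 1) : θ y = 1 := by
  let e := localPiEquiv L (IsCMField.complexConj L) N (Matrix.of fun i j : Fin N => if i.val + j.val + 1 = N then (1 : L) else 0) v
  have h1 : (θ.comp e.toMonoidHom) (e.symm y) = 1 :=
    localPi_apply_eq_one_of_isotropic L _ ((map_cmConjRingHom_eq_map_complexConj L _) ▸ antidiagOne_isHermitian L N)
      (isUnit_antidiagOne_det L N).ne_zero (antidiagOne_isotropic L hN) v (θ.comp e.toMonoidHom) _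
      (det_localPiEquiv_symm_apply_eq_one (IsCMField.complexConj L) y hy)
  have h2 : (θ.comp e.toMonoidHom) (e.symm y) = θ y := by
    change θ (e (e.symm y)) = θ y
    rw [ContinuousMulEquiv.apply_symm_apply]
  rw [← h2, h1]

/-- **(C1) ONE-DIMENSIONAL CHARACTERS OF `H_v = U(Φ₂)(L⁺_v) × U(Φ₁)(L⁺_v)` ARE STABLE CLASS FUNCTIONS** — the registered statement of `stub_xiStablyInvariant`
(line «CMCharIdentityTest» :293), closed by `exact`: the `U(Φ₁)`-components of stable conjugates are equal (★ `isStablyConj_iff_eq_of_fin_one`), the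
`U(Φ₂)`-components have equal determinants (§1), so `b = a · (u, 1)` with `det u = 1`, and `ξ_v(u, 1) = 1` by §2 at `N = 2`.
[cite: Rogawski1990, §3.1 p. 19; §4.8 p. 53; §12.5 p. 183] [cite: Dieudonne1971GroupesClassiques, Chap. II §5] -/
theorem xiStablyInvariant :
  ∀ (L : Type) [Field L] [NumberField L] [IsCMField L] (v : HeightOneSpectrum (𝓞 ↥(maximalRealSubfield L)))
    (ξv : (UnitaryGroup.cmDatum L 2 (Matrix.of fun i j : Fin 2 => if i.val + j.val + 1 = 2 then (1 : L) else 0)).Local v ×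
        (UnitaryGroup.cmDatum L 1 (Matrix.of fun i j : Fin 1 => if i.val + j.val + 1 = 1 then (1 : L) else 0)).Local v →* ℂˣ)
    (a b : (UnitaryGroup.cmDatum L 2 (Matrix.of fun i j : Fin 2 => if i.val + j.val + 1 = 2 then (1 : L) else 0)).Local v ×
        (UnitaryGroup.cmDatum L 1 (Matrix.of fun i j : Fin 1 => if i.val + j.val + 1 = 1 then (1 : L) else 0)).Local v),
    IsLocalStablyConjH L v a b → ξv a = ξv b := by
  intro L _ _ _ v ξv a b hab
  obtain ⟨h₁, h₂⟩ := hab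
  have hb2 : a.2 = b.2 := isStablyConj_iff_eq_of_fin_one.1 h₂
  have hdet := det_eq_of_isStablyConj h₁
  -- `u := a₁⁻¹ b₁` has determinant one and `b = a · (u, 1)`
  have hu : Matrix.GeneralLinearGroup.det (((a.1⁻¹ * b.1 : (UnitaryGroup.cmDatum L 2
      (Matrix.of fun i j : Fin 2 => if i.val + j.val + 1 = 2 then (1 : L) else 0)).Local v)).1 : GL (Fin 2) (LocalRing L v)) = 1 := by
    change Matrix.GeneralLinearGroup.det (a.1.1⁻¹ * b.1.1) = 1
    rw [map_mul, map_inv, hdet, inv_mul_cancel]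
  have hb : b = a * (a.1⁻¹ * b.1, 1) := by
    refine Prod.ext ?_ ?_
    · simp only [Prod.fst_mul, mul_inv_cancel_left]
    · simp only [Prod.snd_mul, mul_one, hb2]
  have hker : ξv (a.1⁻¹ * b.1, 1) = 1 := by
    have h := apply_eq_one_of_det_eq_one_antidiagOne L (N := 2) le_rfl v (ξv.comp (MonoidHom.inl _ _)) (a.1⁻¹ * b.1) hu
    simpa only [MonoidHom.coe_comp, Function.comp_apply, MonoidHom.inl_apply] using h
  rw [hb, map_mul, hker, mul_one]

end CM

end Summit.HodgeConjecture.HodgeConjecture.Cruxes.H413.F0P3bXiStablyInvariant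

end
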